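/-
Copyright (c) 2026 the pub-hodgecm-mathlib formalisation cell (harness21).  Prover seat hodgecm-mathlib-K2Liu-p09 (g3): Track B «K2-LIT», #184♮ = hLiu418,
payer-internal organ O4 «Λ-BOUNDS AT SPLIT PLACES» of file #34 `Theorems/K2LiuDoublingZetaGL1.lean` (LEAD F0P6-plan (g10) DEAL K2/STATUS 2026-09-04T02:36:29Z;
REPORT-FIRST #34 v3, K2/K2Liu-p09/g3).
-/
import Summits.HodgeConjecture.HodgeConjecture.Theorems.K2LiuUnramifiedDoublingHeckeIdentity   -- ★ #28s and its whole ★ import cone (#26, #27, F2, Prelims)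
import HarnessLib

/-!
# Crux `HLiu418`, Track B road `K2_Liu`, file #34 — organ O4 (split half) «THE UNRAMIFIED LOCAL SECTION `Λ_{s,v} ∘ ι_v(·,1)` IS `L¹` ON `U(V)(L⁺_v)`
# WITH `∫ |Λ| ≤ 1 + C·q_v^{−Re s}` AT EVERY SPLIT GOOD PLACE»

Cell `hodgecm-mathlib`, crux item hLiu418 = `stmt-HodgeConjecture-24832`, route of record `HCCMUnconditional`; squad K2 ∕ K2Liu, prover K2Liu-p09 (g3).
THEOREMS ONLY (no `def`, no instance, no notation, no named-fact hypothesis, no `sorry`); lane `--supports stmt-HodgeConjecture-24832 --as helper`.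

★ #29s `K2LiuDoublingPartialEuler.doublingPartialEuler` carries three binders on the local kernels `Λ_v` off `S`: (ΛK) `Λ_v ≡ 1` on `K_v`, (Λint)
`Λ_v ∈ L¹(ν_v)`, (Λbd) the partial products `∏_{v∈T} ∫ |Λ_v| dν_v` are bounded.  In #34 the kernel is `Λ_v = Λ_{s,v} ∘ ι_v(·,1)` transported along the
docking `localCongr_v` (★ `K2LiuDoublingZetaGL1Factor.factorizable_pullback`).  This file proves the place-by-place estimate behind (Λint)+(Λbd) on the
`U(diag dV)` side at every SPLIT good place `v`, in ★ #28s's frame and with ITS arithmetic (Cartan family ★ #26 `isCartanFamily_localInt_split`, values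
★ #27 `lambdaLoc_iotaLeftLocPi_diagonal_split`, coset counts ★ `ncard_orbit_diag_le` `#(K diag(ϖ^k,1)K ∕ K) ≤ 2q^k`, ★ `measure_doubleCoset_eq_ncard_mul`):
* `exists_integral_norm_lambdaLoc_le`: for every `σ₀ > 0` there is ONE constant `C = C(σ₀) ≥ 0` such that at every split good `v` (non-dyadic, `dV`
  units, `gramR^{±1}` integral, `χ` unitary and unramified above `v`), every `s` with `σ₀ ≤ Re s`, and every Haar `ν` with `ν(K_v) = 1`:
  `Λ_{s,v} ∘ ι_v(·,1) ∈ L¹(ν)` and `∫ ‖Λ_{s,v}(ι_v(g,1))‖ dν(g) ≤ 1 + C · q_w^{−Re s}` (`q_w = N(w)` for the chosen `w ∣ v`).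
  Proof: `∫ ‖Λ‖ = Σ_a ‖Λ(t_a)‖ ν(K t_a K)` over the Cartan lattice `a = (a₀ ≥ a₁) ∈ ℤ²`; the `a = 0` term is `ν(K) = 1`; for `a ≠ 0`,
  `‖Λ(t_a)‖ ν(K t_a K) ≤ 2 q^{a₀−a₁} q^{−(σ+1)(|a₀|+|a₁|)} ≤ 2 (q^{−σ})^{|a₀|+|a₁|} ≤ 2·2^{σ₀}·q^{−σ}·(2^{−σ₀})^{|a₀|+|a₁|}`, and
  `Σ_a (2^{−σ₀})^{|a₀|+|a₁|} < ∞` (★ `summable_cartan_bound` at `q = 1`).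
The payer sums `q_w^{−σ} ≤ q_v^{−σ}`-type terms over the good places (`σ > 1`) to get (Λbd); the INERT good places are the twin statement of the inert
package (U5e, hypothesis `hInert` of #34 until typed and paid).

HONEST LABEL: HC_CM is proved only modulo the printed citations (2 remaining named inputs: hLiu418 = stmt-HodgeConjecture-24832,
h413 = stmt-HodgeConjecture-24833) until rung 0 closes; this file is bookkeeping toward socket s23 and closes no item.
References: [Li1992] §3 Thm. 3.1; [GelbartPiatetskishapiroRallis1987] Part A §6; [Macdonald1995] Ch. V §2 (2.9); [CasselsFrohlichANT1967] Ch. XV §3.3.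
-/

set_option autoImplicit false
set_option linter.dupNamespace false

noncomputable section

open scoped Matrix Pointwise
open NumberField IsDedekindDomain Matrix MeasureTheory MulAction ValuativeRel

namespace Summit.HodgeConjecture.HodgeConjecture.Cruxes.HLiu418.K2LiuDoublingZetaGL1LambdaSplit

open Literature.NumberTheory.Automorphic Literature.NumberTheory.Automorphic.UnitaryGroup Literature.NumberTheory.GaloisRepresentations
open Literature.NumberTheory.GelbartRogawski1991 Literature.NumberTheory.GelbartRogawski1991.GRConstruction
open Literature.NumberTheory.GelbartRogawski1991.UnitaryDualPair
open Literature.NumberTheory.K2Lit Literature.NumberTheory.K2Lit.SiegelDoubled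
open Summit.HodgeConjecture.HodgeConjecture.Cruxes.HLiu418.K2LiuCartanFamilySplit
open Summit.HodgeConjecture.HodgeConjecture.Cruxes.HLiu418.K2LiuUnramifiedSectionOnCartan
open Summit.HodgeConjecture.HodgeConjecture.Cruxes.HLiu418.K2LiuDoublingHeckeCartanSum
open Summit.HodgeConjecture.HodgeConjecture.Cruxes.HLiu418.K2LiuGL2PrimitiveCosets
open Summit.HodgeConjecture.HodgeConjecture.Cruxes.HLiu418.K2LiuGL2HeckePrimitiveSplit
open Summit.HodgeConjecture.HodgeConjecture.Cruxes.HLiu418.K2LiuGL2PrimitiveCosetCount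
open Summit.HodgeConjecture.HodgeConjecture.Cruxes.HLiu418.K2LiuUnramifiedDoublingHeckePrelims

/-! ## §1 The Cartan lattice of `GL₂`: the size `|a₀| + |a₁|` -/

/-- on the Cartan lattice `a₀ ≥ a₁`: `a₀ − a₁ ≤ |a₀| + |a₁|` (in `ℕ`, with `Int.toNat`). [cite: Macdonald1995, Ch. V §2] -/
theorem toNat_sub_le_size (a : {a : Fin 2 → ℤ // Antitone a}) :
    (a.1 0 - a.1 1).toNat ≤ ((a.1 0).toNat + (a.1 1).toNat) + ((-a.1 0).toNat + (-a.1 1).toNat) := by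
  have h := a.2 (show (0 : Fin 2) ≤ 1 from Fin.zero_le _)
  omega

/-- on the Cartan lattice: `|a₀| + |a₁| = 0` only at `a = (0, 0)`. [cite: Macdonald1995, Ch. V §2] -/
theorem eq_zero_of_size_eq_zero (a : {a : Fin 2 → ℤ // Antitone a})
    (h : ((a.1 0).toNat + (a.1 1).toNat) + ((-a.1 0).toNat + (-a.1 1).toNat) = 0) : a.1 = ![((0 : ℕ) : ℤ), 0] := by
  funext i
  fin_cases i
  · simp only [Fin.zero_eta, Fin.isValue, Nat.cast_zero, cons_val_zero]; omega
  · simp only [Fin.mk_one, Fin.isValue, Nat.cast_zero, cons_val_one, cons_val_zero]; omega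

/-- **the universal comparison series**: for `0 < σ₀`, `Σ_a (2^{−σ₀})^{|a₀|+|a₁|} < ∞` over the Cartan lattice (★ `summable_cartan_bound` at `q = 1`).
[cite: Macdonald1995, Ch. V §2 (2.9)] -/
theorem summable_size_geometric {y : ℝ} (hy0 : 0 ≤ y) (hy1 : y < 1) :
    Summable fun a : {a : Fin 2 → ℤ // Antitone a} => y ^ (((a.1 0).toNat + (a.1 1).toNat) + ((-a.1 0).toNat + (-a.1 1).toNat)) := by
  have h := summable_cartan_bound (q := 1) le_rfl hy0 (by rwa [one_mul])
  exact h.congr fun a => by rw [one_pow, one_mul]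

/-- the elementary bound behind O4: for `2 ≤ q`, `0 < σ₀ ≤ σ`, `k ≤ m`, `1 ≤ m`:
`q^k · (q^{−(σ+1)})^m ≤ 2^{σ₀} · q^{−σ} · (2^{−σ₀})^m`. [cite: Li1992, §3 Thm. 3.1] -/
theorem pow_mul_rpow_pow_le {q : ℕ} (hq : 2 ≤ q) {σ₀ σ : ℝ} (hσ₀ : 0 < σ₀) (hσ : σ₀ ≤ σ) {k m : ℕ} (hkm : k ≤ m) (hm : 1 ≤ m) :
    (q : ℝ) ^ k * ((q : ℝ) ^ (-(σ + 1))) ^ m ≤ (2 : ℝ) ^ σ₀ * (q : ℝ) ^ (-σ) * ((2 : ℝ) ^ (-σ₀)) ^ m := by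
  have hq0 : (0 : ℝ) < q := by exact_mod_cast (show 0 < q by omega)
  have hq1 : (1 : ℝ) ≤ q := by exact_mod_cast (show 1 ≤ q by omega)
  have hq2 : (2 : ℝ) ≤ q := by exact_mod_cast hq
  -- `x := q^{-σ}`, `y := 2^{-σ₀}`, `x ≤ y`
  set x : ℝ := (q : ℝ) ^ (-σ) with hx
  set y : ℝ := (2 : ℝ) ^ (-σ₀) with hy
  have hx0 : 0 ≤ x := Real.rpow_nonneg hq0.le _
  have hy0 : 0 < y := Real.rpow_pos_of_pos two_pos _
  have hxy : x ≤ y := by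
    calc x = (q : ℝ) ^ (-σ) := rfl
      _ ≤ (q : ℝ) ^ (-σ₀) := Real.rpow_le_rpow_of_exponent_le hq1 (by linarith)
      _ ≤ (2 : ℝ) ^ (-σ₀) := Real.rpow_le_rpow_of_nonpos two_pos hq2 (by linarith)
  -- `q^{-(σ+1)} = x · q⁻¹`
  have hρ : (q : ℝ) ^ (-(σ + 1)) = x * (q : ℝ)⁻¹ := by
    rw [hx, show -(σ + 1) = -σ + (-1) by ring, Real.rpow_add hq0, Real.rpow_neg_one]
  -- `q^k (x q⁻¹)^m = x^m · q^k / q^m ≤ x^m`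
  have h1 : (q : ℝ) ^ k * ((q : ℝ) ^ (-(σ + 1))) ^ m ≤ x ^ m := by
    rw [hρ, mul_pow, inv_pow]
    have hkm' : (q : ℝ) ^ k ≤ (q : ℝ) ^ m := pow_le_pow_right₀ hq1 hkm
    have hqm : 0 < (q : ℝ) ^ m := pow_pos hq0 m
    calc (q : ℝ) ^ k * (x ^ m * ((q : ℝ) ^ m)⁻¹) = x ^ m * ((q : ℝ) ^ k / (q : ℝ) ^ m) := by ring
      _ ≤ x ^ m * 1 := by
          refine mul_le_mul_of_nonneg_left ((div_le_one hqm).2 hkm') (pow_nonneg hx0 m)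
      _ = x ^ m := mul_one _
  -- `x^m = x · x^{m-1} ≤ x · y^{m-1} = 2^{σ₀} x y^m`
  have h2 : x ^ m ≤ (2 : ℝ) ^ σ₀ * x * y ^ m := by
    obtain ⟨m', rfl⟩ : ∃ m', m = m' + 1 := ⟨m - 1, by omega⟩
    have hyinv : (2 : ℝ) ^ σ₀ * y = 1 := by
      rw [hy, ← Real.rpow_add two_pos, add_neg_cancel, Real.rpow_zero]
    calc x ^ (m' + 1) = x * x ^ m' := by ring
      _ ≤ x * y ^ m' := mul_le_mul_of_nonneg_left (pow_le_pow_left₀ hx0 hxy m') hx0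
      _ = ((2 : ℝ) ^ σ₀ * y) * x * y ^ m' := by rw [hyinv, one_mul]
      _ = (2 : ℝ) ^ σ₀ * x * y ^ (m' + 1) := by ring
  exact h1.trans h2

/-! ## §2 The estimate at one split good place -/

set_option maxHeartbeats 1600000 in -- the adelic unitary datum: `localPi`, `localInt`, `localPiSplitEquiv`, `LambdaLoc`, Cartan family (as ★ #28s)
/-- **ORGAN O4 OF #34 (SPLIT HALF) — `Λ_{s,v} ∘ ι_v(·,1)` IS `L¹` WITH `∫ |Λ| ≤ 1 + C(σ₀)·q^{−Re s}` AT A SPLIT GOOD PLACE.**  For every `σ₀ > 0` there is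
`C ≥ 0` such that, in ★ #28s's frame (`e : Fin 2 × Fin 1 ≃ Fin n`, `dV dW ≠ 0`, a split place `w ∣ v` of good reduction: non-dyadic, `dV` units,
`gramR^{±1}` integral; `χ` unitary, unramified above `v`; Haar `ν` on `U(V)(L⁺_v)` with `ν(K_v) = 1`), for every `s` with `σ₀ ≤ Re s`:
`g ↦ Λ_{s,v}(ι_v(g,1))` is `ν`-integrable and `∫ ‖Λ_{s,v}(ι_v(g,1))‖ dν ≤ 1 + C · N(w)^{−Re s}`.
[cite: Li1992, §3 Thm. 3.1] [cite: GelbartPiatetskishapiroRallis1987, Part A §6] [cite: Macdonald1995, Ch. V §2 (2.9)] -/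
theorem exists_integral_norm_lambdaLoc_le (σ₀ : ℝ) (hσ₀ : 0 < σ₀) :
    ∃ C : ℝ, 0 ≤ C ∧
    ∀ (L : Type) [Field L] [NumberField L] [IsCMField L] {n : ℕ} (e : Fin 2 × Fin 1 ≃ Fin n)
      (dV : Fin 2 → L) (hdV : ∀ i, IsCMField.complexConj L (dV i) = dV i) (_hdV0 : ∀ i, dV i ≠ 0)
      (dW : Fin 1 → L) (hdW : ∀ i, IsCMField.complexConj L (dW i) = dW i) (_hdW0 : ∀ i, dW i ≠ 0)
      (v : HeightOneSpectrum (𝓞 (Fp L)))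
      (w : UnitaryGroup.PlacesOver L v) (_hw : IsCMField.complexConj L • w.1 ≠ w.1)
      (_h2 : ∀ w' : UnitaryGroup.PlacesOver L v, ValuativeRel.valuation (w'.1.adicCompletion L) (2 : w'.1.adicCompletion L) = 1)
      (_hdVw : ∀ (w' : UnitaryGroup.PlacesOver L v) (i : Fin 2),
        ValuativeRel.valuation (w'.1.adicCompletion L) (algebraMap L (w'.1.adicCompletion L) (dV i)) = 1)
      (_hT : ∀ (w' : UnitaryGroup.PlacesOver L v) (i j : Fin n), ValuativeRel.valuation (w'.1.adicCompletion L)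
        (algebraMap L (w'.1.adicCompletion L) (algebraMap (Fp L) L (gramR L e dV hdV dW hdW i j))) ≤ 1)
      (_hTinv : ∀ (w' : UnitaryGroup.PlacesOver L v) (i j : Fin n), ValuativeRel.valuation (w'.1.adicCompletion L)
        (algebraMap L (w'.1.adicCompletion L) (algebraMap (Fp L) L ((gramR L e dV hdV dW hdW)⁻¹ i j))) ≤ 1)
      (χ : HeckeCharacter L) (_hχu : χ.IsUnitary) (_hχ : ∀ w' : UnitaryGroup.PlacesOver L v, χ.IsUnramifiedAt w'.1)
      (s : ℂ) (_hs : σ₀ ≤ s.re)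
      [MeasurableSpace (UnitaryGroup.localPi L (IsCMField.complexConj L) 2 (Matrix.diagonal dV) v)]
      [BorelSpace (UnitaryGroup.localPi L (IsCMField.complexConj L) 2 (Matrix.diagonal dV) v)]
      (ν : Measure (UnitaryGroup.localPi L (IsCMField.complexConj L) 2 (Matrix.diagonal dV) v)) [ν.IsHaarMeasure]
      (_hνK : ν (UnitaryGroup.localInt L (IsCMField.complexConj L) 2 (Matrix.diagonal dV) v :
          Set (UnitaryGroup.localPi L (IsCMField.complexConj L) 2 (Matrix.diagonal dV) v)) = 1),
      Integrable (fun g => LambdaLoc L e dV hdV dW hdW v χ s (iotaLeftLocPi L e dV hdV dW hdW v g)) ν ∧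
        ∫ g, ‖LambdaLoc L e dV hdV dW hdW v χ s (iotaLeftLocPi L e dV hdV dW hdW v g)‖ ∂ν ≤
          1 + C * (w.1.residueCard : ℝ) ^ (-s.re) := by
  -- ### the constant
  set y : ℝ := (2 : ℝ) ^ (-σ₀) with hydef
  have hy0 : 0 ≤ y := (Real.rpow_pos_of_pos two_pos _).le
  have hy1 : y < 1 := Real.rpow_lt_one_of_one_lt_of_neg one_lt_two (by linarith)
  set S₀ : ℝ := ∑' a : {a : Fin 2 → ℤ // Antitone a}, y ^ (((a.1 0).toNat + (a.1 1).toNat) + ((-a.1 0).toNat + (-a.1 1).toNat)) with hS₀def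
  have hS₀sum := summable_size_geometric hy0 hy1
  have hS₀0 : 0 ≤ S₀ := tsum_nonneg fun _ => pow_nonneg hy0 _
  refine ⟨2 * (2 : ℝ) ^ σ₀ * S₀, by positivity, ?_⟩
  intro L _ _ _ n e dV hdV hdV0 dW hdW hdW0 v w hw h2 hdVw hT hTinv χ hχu hχ s hs _ _ ν _ hνK
  classical
  haveI : Algebra.IsQuadraticExtension (Fp L) L := IsCMField.isQuadraticExtension L
  set Kv := UnitaryGroup.localInt L (IsCMField.complexConj L) 2 (Matrix.diagonal dV) v with hKvdef
  -- ### the place data: uniformizer, residue cardinality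
  have hϖv : Valued.v (HeckeCharacter.uniformizer L w.1 : w.1.adicCompletion L) = WithZero.exp (-1 : ℤ) :=
    HeckeCharacter.valued_uniformizer (K := L) (v := w.1)
  have hϖU : IsUniformizingElement (HeckeCharacter.uniformizer L w.1 : w.1.adicCompletion L) := isUniformizingElement_of_valued_eq L w.1 hϖv
  have hϖ0 : (HeckeCharacter.uniformizer L w.1 : w.1.adicCompletion L) ≠ 0 := ne_zero_of_valued_eq L hϖv
  set q : ℕ := w.1.residueCard with hqdef
  have hqcard : Nat.card 𝓀[w.1.adicCompletion L] = q := by rw [hqdef, ← residueFieldCard_adicCompletion_eq]; rfl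
  have hq1 : 1 < q := by rw [← hqcard]; exact Finite.one_lt_card
  have hq2 : 2 ≤ q := hq1
  have hqpos : 0 < q := by omega
  have hnormϖ : ‖(HeckeCharacter.uniformizer L w.1 : w.1.adicCompletion L)‖ = (q : ℝ)⁻¹ := HeckeCharacter.norm_uniformizer w.1
  -- ### the split frame `e_w : G_v ≃ GL₂(L_w)` and the compact open `K_v`
  have hJi := unit_placeForm_diagonal_mem_glInt L dV hdV0 w.1 (hdVw w)
  set eW := UnitaryGroup.localPiSplitEquiv (IsCMField.complexConj L) (Matrix.diagonal dV) (IsCMField.complexConj_ne_one L)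
    (transpose_map_diagonal L dV hdV) w hw (isUnit_placeForm_diagonal L dV hdV0 w.1) with heWdef
  have hKi : ∀ g : GL (Fin 2) (w.1.adicCompletion L), eW.symm g ∈ Kv ↔ g ∈ glInt 2 (w.1.adicCompletion L) := fun g =>
    UnitaryGroup.localPiSplitEquiv_symm_mem_localInt_iff (IsCMField.complexConj L) (Matrix.diagonal dV) (IsCMField.complexConj_ne_one L)
      (transpose_map_diagonal L dV hdV) w hw (isUnit_placeForm_diagonal L dV hdV0 w.1) hJi g
  have hKe : ∀ g : UnitaryGroup.localPi L (IsCMField.complexConj L) 2 (Matrix.diagonal dV) v,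
      eW g ∈ glInt 2 (w.1.adicCompletion L) ↔ g ∈ Kv := fun g => by
    rw [← hKi, ContinuousMulEquiv.symm_apply_apply]
  have hKopen : IsOpen (Kv : Set (UnitaryGroup.localPi L (IsCMField.complexConj L) 2 (Matrix.diagonal dV) v)) :=
    UnitaryGroup.isOpen_localInt L (IsCMField.complexConj L) 2 (Matrix.diagonal dV) v
  have hKcpt : IsCompact (Kv : Set (UnitaryGroup.localPi L (IsCMField.complexConj L) 2 (Matrix.diagonal dV) v)) :=
    UnitaryGroup.isCompact_localInt L (IsCMField.complexConj L) 2 (Matrix.diagonal dV) v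
  -- the central element `z = diag(ϖ, ϖ)` of `GL₂(L_w)`
  set z : GL (Fin 2) (w.1.adicCompletion L) := zpowDiagGL hϖ0 (fun _ : Fin 2 => (1 : ℤ)) with hzdef
  -- ### finiteness and size of the relevant `GL₂(𝒪_w)`-orbits (★ F2 `ncard_orbit_diag_le`)
  have hfinD : ∀ k : ℕ, (orbit (glInt 2 (w.1.adicCompletion L))
      ((zpowDiagGL hϖ0 ![(k : ℤ), 0] : GL (Fin 2) (w.1.adicCompletion L)) : GL (Fin 2) (w.1.adicCompletion L) ⧸ glInt 2 (w.1.adicCompletion L))).Finite :=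
    fun k => finite_orbit_diag hϖU k
  have hzcomm : ∀ (j : ℤ), ∀ κ ∈ glInt 2 (w.1.adicCompletion L), κ * z ^ j = z ^ j * κ :=
    fun j κ hκ => ((show Commute κ z from glInt_mul_scalar_comm hϖ0 κ hκ).zpow_right j).eq
  have hfinzD : ∀ (j : ℤ) (k : ℕ), (orbit (glInt 2 (w.1.adicCompletion L))
      ((z ^ j * zpowDiagGL hϖ0 ![(k : ℤ), 0] : GL (Fin 2) (w.1.adicCompletion L)) : GL (Fin 2) (w.1.adicCompletion L) ⧸ glInt 2 (w.1.adicCompletion L))).Finite ∧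
      (orbit (glInt 2 (w.1.adicCompletion L)) ((z ^ j * zpowDiagGL hϖ0 ![(k : ℤ), 0] : GL (Fin 2) (w.1.adicCompletion L)) :
        GL (Fin 2) (w.1.adicCompletion L) ⧸ glInt 2 (w.1.adicCompletion L))).ncard ≤ 2 * q ^ k := by
    intro j k
    rw [orbit_mk_mul_eq_image _ (hzcomm j), Set.ncard_image_of_injective _ (MulAction.injective (z ^ j)), ← hqcard]
    exact ⟨(hfinD k).image _, ncard_orbit_diag_le hϖU k⟩
  -- ### the Cartan family (★ #26) in the coordinates `(j + k, j)`
  set t : {a : Fin 2 → ℤ // Antitone a} → UnitaryGroup.localPi L (IsCMField.complexConj L) 2 (Matrix.diagonal dV) v :=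
    fun a => eW.symm (zpowDiagGL hϖ0 a.1) with htdef
  have hCartan : IsCartanFamily Kv t :=
    isCartanFamily_localInt_split L dV hdV hdV0 v w hw (hdVw w) hϖv
  have hdecomp : ∀ a : {a : Fin 2 → ℤ // Antitone a},
      zpowDiagGL hϖ0 a.1 = z ^ (a.1 1) * zpowDiagGL hϖ0 ![(((a.1 0 - a.1 1).toNat : ℕ) : ℤ), 0] := by
    intro a
    have hk : (((a.1 0 - a.1 1).toNat : ℕ) : ℤ) = a.1 0 - a.1 1 := Int.toNat_of_nonneg (sub_nonneg.2 (a.2 (Fin.zero_le _)))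
    have hzj : z ^ (a.1 1) = zpowDiagGL hϖ0 (fun _ : Fin 2 => a.1 1) := by
      rw [hzdef, zpowDiagGL, zpowDiagGL, ← map_zpow]
      exact congrArg _ (funext fun i => by simp)
    rw [hzj, ← zpowDiagGL_add]
    congr 1
    funext i
    fin_cases i <;> simp [hk]
  have hmapK : (glInt 2 (w.1.adicCompletion L)).map eW.symm.toMonoidHom = Kv := by
    ext g
    constructor
    · rintro ⟨g', hg', rfl⟩
      exact (hKi g').2 hg'
    · intro hg
      exact ⟨eW g, (hKe g).2 hg, eW.symm_apply_apply g⟩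
  have horbG : ∀ a : {a : Fin 2 → ℤ // Antitone a},
      (orbit Kv (t a : UnitaryGroup.localPi L (IsCMField.complexConj L) 2 (Matrix.diagonal dV) v ⧸ Kv)).Finite ∧
      (orbit Kv (t a : UnitaryGroup.localPi L (IsCMField.complexConj L) 2 (Matrix.diagonal dV) v ⧸ Kv)).ncard ≤ 2 * q ^ (a.1 0 - a.1 1).toNat := by
    intro a
    have hG := hfinzD (a.1 1) (a.1 0 - a.1 1).toNat
    rw [← hdecomp a] at hG
    have h := finite_orbit_map_and_ncard_eq eW.symm.toMonoidHom eW.symm.injective (glInt 2 (w.1.adicCompletion L)) (zpowDiagGL hϖ0 a.1) hG.1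
    rw [hmapK] at h
    exact ⟨h.1, h.2 ▸ hG.2⟩
  have hvol : ∀ a : {a : Fin 2 → ℤ // Antitone a},
      (ν (DoubleCoset.doubleCoset (t a) (Kv : Set _) Kv)).toReal ≤ 2 * (q : ℝ) ^ (a.1 0 - a.1 1).toNat := by
    intro a
    rw [measure_doubleCoset_eq_ncard_mul _ ν hKopen (t a) (horbG a).1, hνK, mul_one, ENNReal.toReal_natCast]
    exact_mod_cast (horbG a).2
  have hm : ∀ g : UnitaryGroup.localPi L (IsCMField.complexConj L) 2 (Matrix.diagonal dV) v,
      MeasurableSet (DoubleCoset.doubleCoset g (Kv : Set _) Kv) := fun g => measurableSet_doubleCoset hKopen g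
  have hfin : ∀ a : {a : Fin 2 → ℤ // Antitone a}, ν (DoubleCoset.doubleCoset (t a) (Kv : Set _) Kv) < ⊤ := fun a =>
    ((hKcpt.mul isCompact_singleton).mul hKcpt).measure_lt_top
  -- ### the kernel: bi-`K_v`-invariance (★ D7d) and values on the family (★ #27)
  set Λ' : UnitaryGroup.localPi L (IsCMField.complexConj L) 2 (Matrix.diagonal dV) v → ℂ :=
    fun g => LambdaLoc L e dV hdV dW hdW v χ s (iotaLeftLocPi L e dV hdV dW hdW v g) with hΛ'def
  have hΛ : ∀ x ∈ Kv, ∀ y ∈ Kv, ∀ g : UnitaryGroup.localPi L (IsCMField.complexConj L) 2 (Matrix.diagonal dV) v, Λ' (x * g * y) = Λ' g :=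
    fun x hx y hy g => by
    simp only [hΛ'def]
    rw [lambdaLoc_iotaLeft_mul_localInt L e dV hdV dW hdW v χ s hχ (x * g) hy, lambdaLoc_iotaLeft_localInt_mul L e dV hdV dW hdW v χ s hχ g hx]
  have hn2 : n = 2 := by have h := Fintype.card_congr e; simpa using h.symm
  have hTw : ∀ i j, ValuativeRel.valuation (w.1.adicCompletion L)
      (LocalSplitting.gramW (Fp L) L v n (T₀ := gramR L e dV hdV dW hdW) w i j) ≤ 1 := fun i j => hT w i j
  have hTwd : ValuativeRel.valuation (w.1.adicCompletion L) (LocalSplitting.gramW (Fp L) L v n (T₀ := gramR L e dV hdV dW hdW) w).det = 1 := by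
    have h := valuation_det_map_eq_one ((algebraMap L (w.1.adicCompletion L)).comp (algebraMap (Fp L) L))
      (isUnit_det_gramR₀ L e dV hdV hdV0 dW hdW hdW0) (fun i j => hT w i j) (fun i j => hTinv w i j)
    rw [LocalSplitting.gramW, Matrix.map_map]
    exact h
  set A : ℂ := χ.valueAtUniformizer w.1 * (q : ℂ) ^ (-(s + 1)) with hAdef
  set B : ℂ := χ.valueAtUniformizer (UnitaryGroup.PlacesOver.galInv (IsCMField.complexConj L) w).1 * (q : ℂ) ^ (-(s + 1)) with hBdef
  have hΛt : ∀ a : {a : Fin 2 → ℤ // Antitone a},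
      Λ' (t a) = A ^ ((a.1 0).toNat + (a.1 1).toNat) * B ^ ((-a.1 0).toNat + (-a.1 1).toNat) := by
    intro a
    have h := lambdaLoc_iotaLeftLocPi_diagonal_split L e dV hdV dW hdW v χ s hχ hdV0 hdW0 w hw hTw hTwd hϖv a.1 (t a)
      (coe_cartanSplit_apply L dV hdV hdV0 v w hw hϖv a.1)
    simp only [hΛ'def]
    rw [h, Fin.sum_univ_two, Fin.sum_univ_two, one_mul, one_mul, hn2, hnormϖ, show s + ((2 : ℕ) : ℂ) / 2 = s + 1 by push_cast; ring,
      ofReal_inv_pow_cpow hqpos, hAdef, hBdef, mul_pow, mul_pow, pow_add ((q : ℂ) ^ (-(s + 1)))]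
    ring
  set ρ₀ : ℝ := (q : ℝ) ^ (-(s.re + 1)) with hρ₀def
  have hρ₀0 : 0 ≤ ρ₀ := Real.rpow_nonneg (Nat.cast_nonneg q) _
  have hAnorm : ‖A‖ = ρ₀ := by
    rw [hAdef, norm_mul, show ‖χ.valueAtUniformizer w.1‖ = 1 from hχu _, one_mul, Complex.norm_natCast_cpow_of_pos hqpos]
    simp [hρ₀def]
  have hBnorm : ‖B‖ = ρ₀ := by
    rw [hBdef, norm_mul, show ‖χ.valueAtUniformizer (UnitaryGroup.PlacesOver.galInv (IsCMField.complexConj L) w).1‖ = 1 from hχu _, one_mul,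
      Complex.norm_natCast_cpow_of_pos hqpos]
    simp [hρ₀def]
  have hΛnorm : ∀ a : {a : Fin 2 → ℤ // Antitone a}, ‖Λ' (t a)‖ = ρ₀ ^ (((a.1 0).toNat + (a.1 1).toNat) + ((-a.1 0).toNat + (-a.1 1).toNat)) :=
    fun a => by rw [hΛt a, norm_mul, norm_pow, norm_pow, hAnorm, hBnorm, ← pow_add]
  -- ### per double coset: integrability and the bound `∫_{K t_a K} ‖Λ‖ ≤ 2 q^{a₀−a₁} ρ₀^{|a|}`
  have hintS : ∀ a : {a : Fin 2 → ℤ // Antitone a}, IntegrableOn Λ' (DoubleCoset.doubleCoset (t a) (Kv : Set _) Kv) ν := fun a =>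
    IntegrableOn.congr_fun (f := fun _ => Λ' (t a)) (integrableOn_const (hfin a).ne)
      (fun x hx => by simp only [apply_eq_of_mem_doubleCoset hΛ hx]) (hm _)
  have hcoset : ∀ a : {a : Fin 2 → ℤ // Antitone a},
      ∫ x in DoubleCoset.doubleCoset (t a) (Kv : Set _) Kv, ‖Λ' x‖ ∂ν =
        (ν (DoubleCoset.doubleCoset (t a) (Kv : Set _) Kv)).toReal * ρ₀ ^ (((a.1 0).toNat + (a.1 1).toNat) + ((-a.1 0).toNat + (-a.1 1).toNat)) := by
    intro a
    have heq : Set.EqOn (fun x => ‖Λ' x‖) (fun _ => ρ₀ ^ (((a.1 0).toNat + (a.1 1).toNat) + ((-a.1 0).toNat + (-a.1 1).toNat)))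
        (DoubleCoset.doubleCoset (t a) (Kv : Set _) Kv) := fun x hx => by
      simp only [apply_eq_of_mem_doubleCoset hΛ hx, hΛnorm a]
    rw [setIntegral_congr_fun (hm _) heq, setIntegral_const, smul_eq_mul, Measure.real]
  have hbnd : ∀ a : {a : Fin 2 → ℤ // Antitone a},
      ∫ x in DoubleCoset.doubleCoset (t a) (Kv : Set _) Kv, ‖Λ' x‖ ∂ν ≤
        2 * ((q : ℝ) ^ (a.1 0 - a.1 1).toNat * ρ₀ ^ (((a.1 0).toNat + (a.1 1).toNat) + ((-a.1 0).toNat + (-a.1 1).toNat))) := by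
    intro a
    rw [hcoset a]
    calc (ν (DoubleCoset.doubleCoset (t a) (Kv : Set _) Kv)).toReal * ρ₀ ^ (((a.1 0).toNat + (a.1 1).toNat) + ((-a.1 0).toNat + (-a.1 1).toNat))
        ≤ 2 * (q : ℝ) ^ (a.1 0 - a.1 1).toNat * ρ₀ ^ (((a.1 0).toNat + (a.1 1).toNat) + ((-a.1 0).toNat + (-a.1 1).toNat)) :=
          mul_le_mul_of_nonneg_right (hvol a) (pow_nonneg hρ₀0 _)
      _ = _ := by ring
  -- ### integrability (summable coset integrals of the norm)
  have hq1r : (1 : ℝ) ≤ q := by exact_mod_cast hq1.le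
  have hqρ₀ : (q : ℝ) * ρ₀ < 1 := by
    have h : (q : ℝ) * ρ₀ = (q : ℝ) ^ (-s.re) := by
      rw [hρ₀def, show -(s.re + 1) = -s.re + (-1) by ring, Real.rpow_add (by positivity), Real.rpow_neg_one]
      field_simp
    rw [h]
    exact Real.rpow_lt_one_of_one_lt_of_neg (by exact_mod_cast hq1) (by linarith)
  have hsum_bound : Summable fun a : {a : Fin 2 → ℤ // Antitone a} => ∫ x in DoubleCoset.doubleCoset (t a) (Kv : Set _) Kv, ‖Λ' x‖ ∂ν :=
    Summable.of_nonneg_of_le (fun a => integral_nonneg fun x => norm_nonneg _) hbnd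
      ((summable_cartan_bound hq1r hρ₀0 hqρ₀).mul_left 2)
  have hint : Integrable Λ' ν := by
    have key := integrableOn_iUnion_of_summable_integral_norm (μ := ν) hintS hsum_bound
    rw [iUnion_doubleCoset_eq_univ hCartan, integrableOn_univ] at key
    exact key
  refine ⟨hint, ?_⟩
  -- ### the integral of the norm as a Cartan series
  have hseries : HasSum (fun a : {a : Fin 2 → ℤ // Antitone a} => ∫ x in DoubleCoset.doubleCoset (t a) (Kv : Set _) Kv, ‖Λ' x‖ ∂ν)
      (∫ x, ‖Λ' x‖ ∂ν) := by
    have h := hasSum_integral_iUnion (μ := ν) (f := fun x => ‖Λ' x‖) (fun a => hm (t a)) (pairwise_disjoint_doubleCoset hCartan)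
      hint.norm.integrableOn
    rwa [iUnion_doubleCoset_eq_univ hCartan, Measure.restrict_univ] at h
  -- the `a = 0` term is `ν(K_v) · 1 = 1`
  set a₀ : {a : Fin 2 → ℤ // Antitone a} := ⟨![((0 : ℕ) : ℤ), 0], fun i j _ => by fin_cases i <;> fin_cases j <;> simp⟩ with ha₀def
  have ht₀ : t a₀ = 1 := by
    simp only [htdef, ha₀def, zpowDiagGL_zero_zero, map_one]
  have hK₀ : DoubleCoset.doubleCoset (t a₀) (Kv : Set _) Kv = Kv := by
    rw [ht₀]
    ext x
    rw [DoubleCoset.mem_doubleCoset]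
    constructor
    · rintro ⟨a, ha, b, hb, rfl⟩
      rw [mul_one]
      exact Kv.mul_mem ha hb
    · intro hx
      exact ⟨x, hx, 1, Kv.one_mem, by rw [mul_one, mul_one]⟩
  have hterm₀ : ∫ x in DoubleCoset.doubleCoset (t a₀) (Kv : Set _) Kv, ‖Λ' x‖ ∂ν = 1 := by
    rw [hcoset a₀, hK₀, hνK, ENNReal.toReal_one, one_mul]
    simp [ha₀def]
  -- the other terms: `≤ 2·2^{σ₀}·q^{-σ}·y^{|a|}`
  have hterm : ∀ a : {a : Fin 2 → ℤ // Antitone a}, a ≠ a₀ →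
      ∫ x in DoubleCoset.doubleCoset (t a) (Kv : Set _) Kv, ‖Λ' x‖ ∂ν ≤
        2 * (2 : ℝ) ^ σ₀ * (q : ℝ) ^ (-s.re) * y ^ (((a.1 0).toNat + (a.1 1).toNat) + ((-a.1 0).toNat + (-a.1 1).toNat)) := by
    intro a ha
    have hm1 : 1 ≤ ((a.1 0).toNat + (a.1 1).toNat) + ((-a.1 0).toNat + (-a.1 1).toNat) := by
      by_contra h0
      exact ha (Subtype.ext (eq_zero_of_size_eq_zero a (by omega)))
    refine (hbnd a).trans ?_
    have h := pow_mul_rpow_pow_le hq2 hσ₀ hs (toNat_sub_le_size a) hm1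
    calc 2 * ((q : ℝ) ^ (a.1 0 - a.1 1).toNat * ρ₀ ^ (((a.1 0).toNat + (a.1 1).toNat) + ((-a.1 0).toNat + (-a.1 1).toNat)))
        ≤ 2 * ((2 : ℝ) ^ σ₀ * (q : ℝ) ^ (-s.re) * ((2 : ℝ) ^ (-σ₀)) ^ (((a.1 0).toNat + (a.1 1).toNat) + ((-a.1 0).toNat + (-a.1 1).toNat))) :=
          mul_le_mul_of_nonneg_left h zero_le_two
      _ = _ := by rw [hydef]; ring
  -- ### summing up: `∫ ‖Λ‖ = 1 + Σ_{a ≠ 0} ≤ 1 + C q^{-σ}`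
  set F : {a : Fin 2 → ℤ // Antitone a} → ℝ := fun a => ∫ x in DoubleCoset.doubleCoset (t a) (Kv : Set _) Kv, ‖Λ' x‖ ∂ν with hFdef
  set G : {a : Fin 2 → ℤ // Antitone a} → ℝ := fun a =>
    if a = a₀ then 0 else 2 * (2 : ℝ) ^ σ₀ * (q : ℝ) ^ (-s.re) * y ^ (((a.1 0).toNat + (a.1 1).toNat) + ((-a.1 0).toNat + (-a.1 1).toNat)) with hGdef
  have hGsum : Summable G := by
    refine Summable.of_nonneg_of_le (fun a => ?_) (fun a => ?_) (hS₀sum.mul_left (2 * (2 : ℝ) ^ σ₀ * (q : ℝ) ^ (-s.re)))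
    · simp only [hGdef]; split_ifs
      · exact le_rfl
      · positivity
    · simp only [hGdef]; split_ifs
      · positivity
      · exact le_rfl
  have hGtsum : ∑' a, G a ≤ 2 * (2 : ℝ) ^ σ₀ * S₀ * (q : ℝ) ^ (-s.re) := by
    have h1 : ∑' a, G a ≤ ∑' a : {a : Fin 2 → ℤ // Antitone a},
        2 * (2 : ℝ) ^ σ₀ * (q : ℝ) ^ (-s.re) * y ^ (((a.1 0).toNat + (a.1 1).toNat) + ((-a.1 0).toNat + (-a.1 1).toNat)) := by
      refine hGsum.tsum_le_tsum (fun a => ?_) (hS₀sum.mul_left _)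
      simp only [hGdef]; split_ifs
      · positivity
      · exact le_rfl
    rw [tsum_mul_left] at h1
    calc ∑' a, G a ≤ 2 * (2 : ℝ) ^ σ₀ * (q : ℝ) ^ (-s.re) * S₀ := h1
      _ = 2 * (2 : ℝ) ^ σ₀ * S₀ * (q : ℝ) ^ (-s.re) := by ring
  have hFG : ∀ a, (if a = a₀ then (0 : ℝ) else F a) ≤ G a := by
    intro a
    simp only [hGdef]
    split_ifs with h
    · exact le_rfl
    · exact hterm a h
  have hFsum' : Summable fun a => if a = a₀ then (0 : ℝ) else F a := by
    refine Summable.of_nonneg_of_le (fun a => ?_) hFG hGsum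
    split_ifs
    · exact le_rfl
    · exact integral_nonneg fun x => norm_nonneg _
  rw [← hseries.tsum_eq, hseries.summable.tsum_eq_add_tsum_ite a₀]
  have h0 : F a₀ = 1 := hterm₀
  have hrest : (∑' a, if a = a₀ then (0 : ℝ) else F a) ≤ 2 * (2 : ℝ) ^ σ₀ * S₀ * (q : ℝ) ^ (-s.re) :=
    (hFsum'.tsum_le_tsum hFG hGsum).trans hGtsum
  calc (F a₀ + ∑' a, if a = a₀ then (0 : ℝ) else F a) ≤ 1 + 2 * (2 : ℝ) ^ σ₀ * S₀ * (q : ℝ) ^ (-s.re) := by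
        rw [h0]; exact add_le_add le_rfl hrest
    _ = 1 + 2 * (2 : ℝ) ^ σ₀ * S₀ * ((w.1.residueCard : ℕ) : ℝ) ^ (-s.re) := by rw [hqdef]

end Summit.HodgeConjecture.HodgeConjecture.Cruxes.HLiu418.K2LiuDoublingZetaGL1LambdaSplit

end
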